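import Summits.PneNP.PneNP.Theses.DelsarteLasserre

/-!
# Route DelsarteLasserre — `LasserreAttainsCodeSize` (stmt-PneNP-2132)

Soundness of the inline Lasserre hierarchy for `A(n,d)` (Laurent 2006, (17)–(20)): the `0/1` moment vector
`y_S = [S ⊆ C]` of a maximum independent set `C` of the conflict graph is feasible at every level `t` — `y_∅ = 1`,
`y ≥ 0`, `y_{uv} = 0` on conflicts, and the moment matrix is the rank-one PSD matrix `v vᵀ` with `v_I = [I ⊆ C]` — and
`Σ_v y_{v} = |C| = A(n,d)`. Hence every level upper-bounds `A(n,d)`.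
-/

set_option linter.dupNamespace false -- `Summit.PneNP.PneNP.…`: summit = sub-problem name (D-0017 single-conjunct layout)

namespace Summit.PneNP.PneNP.Theorems

open Finset Matrix

/-- **Support item `LasserreAttainsCodeSize` of route DelsarteLasserre (stmt-PneNP-2132)**: the indicator moments
`y_S = [S ⊆ C]` of a maximum independent set `C` of the conflict graph are level-`t` feasible (moment matrix `= v vᵀ`,
`v_I = [I ⊆ C]`) with objective `A(n,d)`. [cite: Laurent2006, (17)–(20)] -/
theorem delsarteLasserre_lasserreAttainsCodeSize_proof :
    Summit.PneNP.PneNP.Theses.DelsarteLasserre.LasserreAttainsCodeSize := by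
  unfold Summit.PneNP.PneNP.Theses.DelsarteLasserre.LasserreAttainsCodeSize
  intro n d t
  classical
  set G : SimpleGraph (Fin n → Bool) := SimpleGraph.fromRel fun u v : Fin n → Bool => hammingDist u v < d with hG
  obtain ⟨C, hC⟩ := G.exists_isNIndepSet_indepNum
  let y : Finset (Fin n → Bool) → ℝ := fun S => if S ⊆ C then 1 else 0
  have hy : ∀ S, y S = if S ⊆ C then 1 else 0 := fun S => rfl
  refine ⟨y, by simp [hy], fun S => by rw [hy]; split_ifs <;> norm_num, ?_, ?_, ?_⟩
  · -- conflicts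
    intro u v huv hdist
    have hadj : G.Adj u v := by
      rw [hG, SimpleGraph.fromRel_adj]
      exact ⟨huv, Or.inl hdist⟩
    rw [hy, if_neg]
    intro hsub
    have hu : u ∈ C := hsub (by simp)
    have hv : v ∈ C := hsub (by simp)
    exact hC.1 hu hv huv hadj
  · -- the moment matrix is `v vᵀ`
    let a : {S : Finset (Fin n → Bool) // S.card ≤ t} → ℝ := fun I => if I.1 ⊆ C then 1 else 0
    have hM : (Matrix.of fun I J : {S : Finset (Fin n → Bool) // S.card ≤ t} => y (I.1 ∪ J.1)) = vecMulVec a a := by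
      ext I J
      simp only [of_apply, vecMulVec_apply, hy, a, Finset.union_subset_iff]
      by_cases hI : I.1 ⊆ C <;> by_cases hJ : J.1 ⊆ C <;> simp [hI, hJ]
    rw [hM]
    have h := posSemidef_vecMulVec_self_star a
    rwa [star_trivial] at h
  · -- the objective
    have hsing : ∀ v : Fin n → Bool, y {v} = if v ∈ C then 1 else 0 := fun v => by
      rw [hy]; simp only [Finset.singleton_subset_iff]
    simp only [hsing, Finset.sum_boole, Finset.filter_mem_eq_inter, Finset.univ_inter]
    rw [hC.2]

end Summit.PneNP.PneNP.Theorems
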